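/-
Copyright (c) 2026. Released under Apache 2.0 license.
-/
import Literature.NumberTheory.ModularForms.EtaMultiplierRademacherPhi

/-!
# The transformation of a weight-`0` `η`-quotient in terms of Rademacher's `Φ`

`ModularCurveEtaQuotientsProofs` proves Newman's theorem (`etaQuotient_smul_of_mem_Gamma0`:
`Γ₀(N)`-invariance of `f(τ) = ∏_{t ∣ N} η(tτ)^{r_t}` under `NewmanCond`), and
`EtaMultiplierRademacherPhi` proves Dedekind's functional equation
`η(γτ) = e^{πi(Φ(γ) − 3)/12} √(cτ+d) η(τ)` (`eta_SL2_smul_rademacherPhi`, `c > 0`)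
[cite: Apostol1990, Thm. 3.4] [cite: RademacherGrosswald1972, Ch. 4 A, eq. (60)].  This short
theorem-only file records the resulting TRANSFORMATION LAW OF THE QUOTIENT ITSELF, for any exponent
vector of weight `0` (`Σ r_t = 0`, no congruence condition) and `γ = (a b; c d)`, `c > 0`, `N ∣ c`:

  `f(γτ) = exp( Σ_t r_t · πi(Φ(γ_t) − 3)/12 ) · f(τ) = exp(2πi · (1/24) Σ_t r_t Φ(γ_t)) · f(τ)`,
  `γ_t = (a, bt; c/t, d)`  (`t·γτ = γ_t(tτ)`; the square roots cancel as `Σ r_t = 0`)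

(`etaQuotient_smul_eq_cexp_sum_rademacherPhi`, `etaQuotient_smul_eq_cexp_logPeriod`) — i.e. the
rational number `(1/24) Σ_t r_t Φ(γ_t)` IS the logarithmic period of `f` along `γ`, the quantity whose
integrality / half-integrality is `etaQuotient_logPeriod_mem_int` / `sum_rademacherPhi_conj_eq_jacobi`
of `EtaMultiplierRademacherPhi` and whose additivity on `Γ₀(N)` is `sum_rademacherPhi_conj_mul` of
`RademacherPhiLogPeriodProofs`.  No new definitions, no named facts.

## References

* [Apostol1990] T. M. Apostol, *Modular Functions and Dirichlet Series in Number Theory*, 2nd ed.,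
  Thm. 3.4.
* [RademacherGrosswald1972] H. Rademacher, E. Grosswald, *Dedekind Sums*, Ch. 4 A, eq. (59)–(60).
-/

noncomputable section

open UpperHalfPlane hiding I
open ModularForm Complex Matrix.SpecialLinearGroup CongruenceSubgroup
open scoped MatrixGroups Real ModularForm CongruenceSubgroup NumberTheorySymbols
open Literature.NumberTheory.ModularForms

namespace Literature.NumberTheory.EllipticCurves.ModularForms

/-- `∏ x^{r t} = x^{Σ r t}` for `x ≠ 0` in `ℂ`. [folklore] -/
private theorem cprod_zpow_eq_zpow_sum {x : ℂ} (hx : x ≠ 0) (s : Finset ℕ) (r : ℕ → ℤ) :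
    ∏ t ∈ s, x ^ r t = x ^ ∑ t ∈ s, r t := by
  induction s using Finset.induction_on with
  | empty => simp
  | insert a s ha ih => rw [Finset.prod_insert ha, Finset.sum_insert ha, ih, zpow_add₀ hx]

/-- **Transformation of a weight-`0` `η`-quotient in terms of `Φ`**: for
`f(τ) = ∏_{t∣N} η(tτ)^{r_t}` with `Σ r_t = 0` and `γ = (a b; c d) ∈ SL₂(ℤ)`, `c > 0`, `N ∣ c`:
`f(γτ) = exp(Σ_t r_t · πi(Φ(a, bt; c/t, d) − 3)/12) · f(τ)`.  (Each factor by Dedekind's functional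
equation at `γ_t = (a, bt; c/t, d)`, `t·γτ = γ_t(tτ)`; the square roots cancel as `Σ r_t = 0`.)
[cite: Apostol1990, Thm. 3.4] [cite: RademacherGrosswald1972, Ch. 4 A, eq. (60)] -/
theorem etaQuotient_smul_eq_cexp_sum_rademacherPhi (N : ℕ) (r : ℕ → ℤ)
    (hsum : ∑ t ∈ N.divisors, r t = 0) (γ : SL(2, ℤ)) (hNc : (N : ℤ) ∣ γ 1 0) (hc : 0 < γ 1 0)
    (τ : ℍ) :
    etaQuotient N r (γ • τ) =
      cexp (∑ t ∈ N.divisors, (r t : ℂ) *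
        (π * I * (((rademacherPhi (γ 0 0) (γ 0 1 * t) (γ 1 0 / t) (γ 1 1) : ℚ) : ℂ) - 3) / 12)) *
        etaQuotient N r τ := by
  -- `c / t` for `t ∣ N`
  have hct : ∀ t ∈ N.divisors, γ 1 0 = t * (γ 1 0 / t) := fun t ht ↦ by
    rw [Int.mul_ediv_cancel']
    exact dvd_trans (Int.natCast_dvd_natCast.mpr (Nat.dvd_of_mem_divisors ht)) hNc
  have hctpos : ∀ t ∈ N.divisors, 0 < γ 1 0 / t := fun t ht ↦ by
    have ht0 : (0 : ℤ) < t := by exact_mod_cast Nat.pos_of_mem_divisors ht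
    have hmul := hct t ht
    rcases lt_trichotomy (γ 1 0 / t) 0 with h | h | h
    · nlinarith
    · rw [h, mul_zero] at hmul; linarith
    · exact h
  set j : ℂ := (γ 1 0 : ℂ) * τ + γ 1 1 with hj
  have hjne : j ≠ 0 := SL2_denom_ne_zero γ τ
  -- each factor, by Dedekind's functional equation at `γ_t`
  have hfactor : ∀ t ∈ N.divisors, η (t * ((γ • τ : ℍ) : ℂ)) =
      cexp (π * I * (((rademacherPhi (γ 0 0) (γ 0 1 * t) (γ 1 0 / t) (γ 1 1) : ℚ) : ℂ) - 3) / 12) *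
        Complex.sqrt j * η (t * (τ : ℂ)) := fun t ht ↦ by
    have ht0 := Nat.pos_of_mem_divisors ht
    obtain ⟨h00, h01, h10, h11⟩ := conjDelta_apply γ t _ (hct t ht)
    have hdet' : γ 0 0 * γ 1 1 - γ 0 1 * t * (γ 1 0 / t) = 1 := by
      have := det_entries (conjDelta γ t _ (hct t ht))
      rwa [h00, h01, h10, h11] at this
    have := eta_SL2_smul (conjDelta γ t _ (hct t ht)) (Or.inl (by rw [h10]; exact hctpos t ht))
      (natMulPt t ht0 τ)
    rw [natMul_coe_SL2_smul γ t ht0 _ (hct t ht), this, etaMultiplierSL, h00, h01, h10, h11,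
      coe_natMulPt, etaMultiplier_eq_cexp_rademacherPhi hdet' (hctpos t ht)]
    congr 2
    rw [hj]
    have : ((γ 1 0 : ℤ) : ℂ) = t * (γ 1 0 / t : ℤ) := by exact_mod_cast hct t ht
    rw [this]; ring
  rw [etaQuotient_apply, etaQuotient_apply, Finset.prod_congr rfl fun t ht ↦ by rw [hfactor t ht]]
  simp_rw [mul_zpow, Finset.prod_mul_distrib]
  -- the square roots cancel
  have hsqrt : ∏ t ∈ N.divisors, Complex.sqrt j ^ (r t) = 1 := by
    have hsne : Complex.sqrt j ≠ 0 := fun h ↦ hjne (by rw [← csqrt_sq j, h]; simp)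
    rw [cprod_zpow_eq_zpow_sum hsne, hsum, zpow_zero]
  -- the multipliers add up in the exponent
  have hmult : ∏ t ∈ N.divisors,
      cexp (π * I * (((rademacherPhi (γ 0 0) (γ 0 1 * t) (γ 1 0 / t) (γ 1 1) : ℚ) : ℂ) - 3) / 12)
        ^ (r t) =
      cexp (∑ t ∈ N.divisors, (r t : ℂ) *
        (π * I * (((rademacherPhi (γ 0 0) (γ 0 1 * t) (γ 1 0 / t) (γ 1 1) : ℚ) : ℂ) - 3) /
          12)) := by
    rw [Complex.exp_sum]
    exact Finset.prod_congr rfl fun t _ ↦ by rw [← Complex.exp_int_mul]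
  rw [hmult, hsqrt, mul_one]

/-- The same with the exponent as `2πi` times the LOG PERIOD `(1/24) Σ_t r_t Φ(a, tb; c/t, d)`:
for `Σ r_t = 0`, `ad − bc = 1`, `c > 0`, `N ∣ c`,
`f(γτ) = exp(2πi · (1/24) Σ_t r_t Φ(a, tb; c/t, d)) · f(τ)` — so that `etaQuotient_logPeriod_mem_int`
(integrality under Newman's conditions) is exactly the `Γ₀(N)`-invariance of `f`, and
`sum_rademacherPhi_conj_eq_jacobi` its Nebentypus. [cite: RademacherGrosswald1972, Ch. 4 A, eq. (60)] -/
theorem etaQuotient_smul_eq_cexp_logPeriod (N : ℕ) (r : ℕ → ℤ)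
    (hsum : ∑ t ∈ N.divisors, r t = 0) {a b c d : ℤ} (hdet : a * d - b * c = 1) (hc : 0 < c)
    (hNc : (N : ℤ) ∣ c) (τ : ℍ) :
    let γ : SL(2, ℤ) := ⟨!![a, b; c, d], by rw [Matrix.det_fin_two_of]; linear_combination hdet⟩
    etaQuotient N r (γ • τ) =
      cexp (2 * π * I *
        (((∑ t ∈ N.divisors, (r t : ℚ) * rademacherPhi a (t * b) (c / t) d) / 24 : ℚ) : ℂ)) *
        etaQuotient N r τ := by
  intro γ
  have hγ00 : γ 0 0 = a := by simp [γ]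
  have hγ01 : γ 0 1 = b := by simp [γ]
  have hγ10 : γ 1 0 = c := by simp [γ]
  have hγ11 : γ 1 1 = d := by simp [γ]
  rw [etaQuotient_smul_eq_cexp_sum_rademacherPhi N r hsum γ (hγ10 ▸ hNc) (hγ10 ▸ hc), hγ00, hγ01,
    hγ10, hγ11]
  congr 2
  have hlin : ∑ t ∈ N.divisors, (r t : ℂ) *
      (π * I * (((rademacherPhi a (t * b) (c / t) d : ℚ) : ℂ) - 3) / 12) =
      π * I / 12 * ∑ t ∈ N.divisors, (r t : ℂ) * ((rademacherPhi a (t * b) (c / t) d : ℚ) : ℂ) -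
        π * I / 4 * ∑ t ∈ N.divisors, (r t : ℂ) := by
    rw [Finset.mul_sum, Finset.mul_sum, ← Finset.sum_sub_distrib]
    exact Finset.sum_congr rfl fun t _ ↦ by ring
  have hsum' : ∑ t ∈ N.divisors, (r t : ℂ) = 0 := by exact_mod_cast hsum
  rw [Finset.sum_congr rfl fun t _ ↦ by rw [mul_comm b (t : ℤ)]]
  push_cast
  linear_combination hlin - (π * I / 4 : ℂ) * hsum'

end Literature.NumberTheory.EllipticCurves.ModularForms
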